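import Summits.NavierStokesRegularity.NavierStokesRegularity.Theses.AdaptedFrequency
import Literature.Analysis.FluidPDE.AdaptedBackwardKernel

/-!
# The hardest stub of line `tauberian-omega-limit` is implied by the crux itself

Support for crux `AdaptedFrequencyConverges` (stmt-NavierStokesRegularity-10493), cdisprove seat, cycle 2:
a TIGHTNESS-OF-DECOMPOSITION fact.  The lead's active skeleton (sha 1b56b576…) proves the crux from
`stub_kernelCalculus`, `stub_pinchingUpper` [landed], `stub_pinchingLower` [landed], `stub_slowDecrease`
and `stub_landau` [landed].  Conversely the crux implies `stub_slowDecrease` by two lines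
(`stub_slowDecrease_of_adaptedFrequencyConverges`: a convergent function is slowly decreasing — the
dyadic-window restriction is not even used).  So, given the landed stubs, the one remaining NS stub is
EQUIVALENT to the crux: the line has isolated the Navier–Stokes content of `AdaptedFrequencyConverges`
(into "slow decrease of `Λ` over dyadic log-time windows at a Type-I singular point"), not reduced it;
and every obstruction recorded against the crux in `Cruxes/AdaptedFrequencyConverges/Disproof.lean`
(far-field load-bearing, no smallness threshold, DSS threat) applies verbatim to `stub_slowDecrease`.
-/

noncomputable section

namespace Summit.NavierStokesRegularity.NavierStokesRegularity.Theorems.AdaptedFrequencyConverges.Negative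

open scoped Topology
open Literature.Analysis.FluidPDE Set Filter MeasureTheory
open Summit.NavierStokesRegularity.NavierStokesRegularity.Theses.AdaptedFrequency

/-- **The crux implies the hardest stub.**  `AdaptedFrequencyConverges` implies the lead's active
`stub_slowDecrease` (skeleton 1b56b576…, statement verbatim): if `Λ = adaptedFrequency u G T` has a
limit at `T⁻` then for every `ε > 0` it is eventually `ε`-slowly decreasing (indeed `ε`-slowly
oscillating, on all late pairs `t ≤ t'`, dyadic or not). [folklore] -/
theorem stub_slowDecrease_of_adaptedFrequencyConverges (hAFC : AdaptedFrequencyConverges) :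
    ∀ (ν T : ℝ) (u : ℝ → EuclideanSpace ℝ (Fin 3) → EuclideanSpace ℝ (Fin 3))
      (p : ℝ → EuclideanSpace ℝ (Fin 3) → ℝ) (x₀ : EuclideanSpace ℝ (Fin 3)) (t₀ : ℝ)
      (G : ℝ → EuclideanSpace ℝ (Fin 3) → ℝ), 0 < ν → 0 < T →
      IsClassicalNSSolutionOn (Ico 0 T) ν 0 u p → IsLerayHopfOn T ν 0 (u 0) u →
      HasRapidSpatialDecay (u 0) → IsTypeIBlowup u T → t₀ ∈ Ico 0 T →
      (∀ r : ℝ, 0 < r → eLpNorm (Function.uncurry u) ⊤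
        (volume.restrict (parabolicCylinder r (T, x₀))) = ⊤) →
      IsAdaptedBackwardKernel ν u (Ico t₀ T) T x₀ G → IsGaussianComparable G (Ico t₀ T) T x₀ →
      ∀ ε : ℝ, 0 < ε → ∃ t₁ : ℝ, t₁ < T ∧ ∀ t t' : ℝ, t₁ ≤ t → t ≤ t' → t' < T →
        T - t ≤ 2 * (T - t') → adaptedFrequency u G T t ≤ adaptedFrequency u G T t' + ε := by
  intro ν T u p x₀ t₀ G hν hT hcl hLH hdec hTI ht₀ hsing hK hcomp ε hε
  obtain ⟨Λ₀, hlim⟩ := hAFC ν T hν hT u p hcl hLH hdec hTI x₀ t₀ G ht₀ hsing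
    (isAdaptedBackwardKernel_iff.1 hK) (isGaussianComparable_iff_fin_three.1 hcomp)
    (adaptedEnstrophy u G) (adaptedFrequency u G T) rfl rfl
  have hev : ∀ᶠ t in 𝓝[<] T, dist (adaptedFrequency u G T t) Λ₀ < ε / 2 :=
    hlim (Metric.ball_mem_nhds Λ₀ (half_pos hε))
  obtain ⟨a, haT, ha⟩ := mem_nhdsLT_iff_exists_Ioo_subset.1 hev
  refine ⟨(a + T) / 2, by linarith [mem_Iio.1 haT], fun t t' h1 h2 h3 _ => ?_⟩
  have haT' : a < T := haT
  have ht : dist (adaptedFrequency u G T t) Λ₀ < ε / 2 := ha ⟨by linarith, h2.trans_lt h3⟩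
  have ht' : dist (adaptedFrequency u G T t') Λ₀ < ε / 2 := ha ⟨by linarith, h3⟩
  rw [Real.dist_eq] at ht ht'
  have h4 := (abs_lt.1 ht).2
  have h5 := (abs_lt.1 ht').1
  linarith

end Summit.NavierStokesRegularity.NavierStokesRegularity.Theorems.AdaptedFrequencyConverges.Negative

end
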